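import Mathlib.LinearAlgebra.PiTensorProduct.Basis
import Mathlib.LinearAlgebra.TensorProduct.Basis
import Mathlib.LinearAlgebra.Dual.Basis
import Mathlib.LinearAlgebra.Eigenspace.Basic
import Literature.AlgebraicGeometry.Motives.EtaleTate
import HarnessLib

/-!
# Tensor bases of `T^{a,b}_K W` and diagonal operators (Mumford–Tate invariants, step 1)

Linear algebra used in the proof of `Deligne1982_mumfordTateInvariants`
(`Literature/AlgebraicGeometry/Motives/MumfordTateInvariants.lean`): for a basis `e` of a
finite-dimensional `K`-vector space `W` we record the induced **tensor basis**
`hodgeTensorBasis e a b` of `T^{a,b}_K W = W^{⊗a} ⊗ (W^∨)^{⊗b}` (`hodgeTensorSpaceOver K W a b` of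
`EtaleTate.lean`), indexed by `(Fin a → S) × (Fin b → S)`:
`(β, γ) ↦ (⊗ₖ e (β k)) ⊗ (⊗ₗ e^∨ (γ l))` with `e^∨` the dual basis, and we compute the action
`tensorSpaceActOver g` of an automorphism `g` that is DIAGONAL in `e` (`g (e σ) = u σ • e σ`):
it is diagonal in the tensor basis with eigenvalue `(∏ₖ u (β k)) (∏ₗ u (γ l))⁻¹`
(`tensorSpaceActOver_hodgeTensorBasis`). This is the computation behind "a tensor
`t ∈ T^{a,b}` is of type `(0,0)` iff it is fixed by `μ(𝔾ₘ)`" in Deligne, *Hodge cycles on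
abelian varieties*, LNM 900, I, proof of Prop. 3.4 (`μ(λ)` acts on `V^{p,q}` by `λ^{-p}`, hence
on a tensor of Hodge type `(P, Q)` by `λ^{-P}`).

We also record generic facts about an endomorphism `D` that is diagonal in a basis `E` of a
module (`D (E i) = d i • E i`): coordinates (`basisRepr_apply_of_diag`), eigenspaces
and kernel as spans of basis vectors (`eigenspace_eq_span_of_diag`, `ker_eq_span_of_diag`),
`ker Dᵏ = ker D` (`ker_pow_eq_ker_of_diag`) and `⨆ eigenspaces = ⊤`
(`iSup_eigenspace_eq_top_of_diag`).

## References

* P. Deligne, *Hodge cycles on abelian varieties* (notes by J. S. Milne), in LNM 900 (1982),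
  I §3, proof of Prop. 3.4.
-/

noncomputable section

open scoped TensorProduct PiTensorProduct

namespace Literature.AlgebraicGeometry.Motives

universe u v w

/-! ### Diagonal endomorphisms in a basis -/

section Diagonal

variable {R : Type u} [CommRing R] {M : Type v} [AddCommGroup M] [Module R M] {ι : Type w}

/-- If `D` is diagonal in the basis `E` with eigenvalues `d`, the `i`-th coordinate of `D x` is
`d i` times the `i`-th coordinate of `x`. [folklore] -/
theorem basisRepr_apply_of_diag (E : Module.Basis ι R M) {D : M →ₗ[R] M} {d : ι → R}
    (hD : ∀ i, D (E i) = d i • E i) (x : M) (i : ι) : E.repr (D x) i = d i * E.repr x i := by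
  classical
  have key : E.coord i ∘ₗ D = d i • E.coord i := E.ext fun j => by
    by_cases h : j = i
    · subst h
      simp [hD]
    · simp [hD, h]
  simpa using LinearMap.congr_fun key x

/-- Powers of an endomorphism diagonal in a basis are diagonal, with the powers of the
eigenvalues. [folklore] -/
theorem basis_pow_apply_of_diag (E : Module.Basis ι R M) {D : M →ₗ[R] M} {d : ι → R}
    (hD : ∀ i, D (E i) = d i • E i) (k : ℕ) (i : ι) : (D ^ k) (E i) = d i ^ k • E i := by
  induction k with
  | zero => simp
  | succ k ih => rw [pow_succ, Module.End.mul_apply, hD, map_smul, ih, smul_smul, mul_comm,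
      ← pow_succ]

/-- The eigenspace of a diagonal endomorphism for the value `c` is spanned by the basis vectors
with eigenvalue `c`. [folklore] -/
theorem eigenspace_eq_span_of_diag (E : Module.Basis ι R M) {D : M →ₗ[R] M} {d : ι → R}
    (hD : ∀ i, D (E i) = d i • E i) [NoZeroDivisors R] (c : R) :
    Module.End.eigenspace D c = Submodule.span R (E '' {i | d i = c}) := by
  ext x
  rw [Module.End.mem_eigenspace_iff, Module.Basis.mem_span_image, ← E.repr.injective.eq_iff]
  constructor
  · intro h i hi
    rw [Finset.mem_coe, Finsupp.mem_support_iff] at hi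
    have h' := congrArg (fun f => f i) h
    simp only [basisRepr_apply_of_diag E hD, map_smul, Finsupp.smul_apply, smul_eq_mul] at h'
    exact mul_right_cancel₀ hi h'
  · intro h
    ext i
    simp only [basisRepr_apply_of_diag E hD, map_smul, Finsupp.smul_apply, smul_eq_mul]
    by_cases hi : E.repr x i = 0
    · simp [hi]
    · rw [h (by simpa using hi)]

/-- The kernel of a diagonal endomorphism is spanned by the basis vectors with eigenvalue `0`.
[folklore] -/
theorem ker_eq_span_of_diag (E : Module.Basis ι R M) {D : M →ₗ[R] M} {d : ι → R}
    (hD : ∀ i, D (E i) = d i • E i) [NoZeroDivisors R] :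
    LinearMap.ker D = Submodule.span R (E '' {i | d i = 0}) := by
  rw [← Module.End.eigenspace_zero, eigenspace_eq_span_of_diag E hD]

/-- For a diagonal endomorphism, `ker Dᵏ = ker D` for `k ≥ 1` (no nilpotent part). [folklore] -/
theorem ker_pow_eq_ker_of_diag (E : Module.Basis ι R M) {D : M →ₗ[R] M} {d : ι → R}
    (hD : ∀ i, D (E i) = d i • E i) [NoZeroDivisors R] {k : ℕ} (hk : k ≠ 0) :
    LinearMap.ker (D ^ k) = LinearMap.ker D := by
  rw [ker_eq_span_of_diag E hD, ker_eq_span_of_diag E (basis_pow_apply_of_diag E hD k)]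
  simp [pow_eq_zero_iff hk]

/-- A diagonal endomorphism is diagonalisable: its eigenspaces span. [folklore] -/
theorem iSup_eigenspace_eq_top_of_diag (E : Module.Basis ι R M) {D : M →ₗ[R] M} {d : ι → R}
    (hD : ∀ i, D (E i) = d i • E i) : ⨆ c, Module.End.eigenspace D c = ⊤ := by
  rw [eq_top_iff, ← E.span_eq, Submodule.span_le]
  rintro _ ⟨i, rfl⟩
  exact Submodule.mem_iSup_of_mem (d i) (Module.End.mem_eigenspace_iff.2 (hD i))

/-- A vector killed by a diagonal endomorphism has zero coordinate at every basis vector with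
non-zero eigenvalue; contrapositively, if `D x ≠ 0` some coordinate `x_i` with `d i ≠ 0` is
non-zero. [folklore] -/
theorem exists_repr_ne_zero_of_diag_apply_ne_zero (E : Module.Basis ι R M) {D : M →ₗ[R] M}
    {d : ι → R} (hD : ∀ i, D (E i) = d i • E i) {x : M} (hx : D x ≠ 0) :
    ∃ i, d i ≠ 0 ∧ E.repr x i ≠ 0 := by
  by_contra h
  simp only [not_exists, not_and, not_not] at h
  apply hx
  rw [← E.repr.injective.eq_iff, map_zero]
  ext i
  rw [basisRepr_apply_of_diag E hD, Finsupp.zero_apply]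
  by_cases hi : d i = 0
  · simp [hi]
  · simp [h i hi]

end Diagonal

/-! ### The tensor basis of `T^{a,b}_K W` -/

section TensorBasis

variable {K : Type u} [Field K] {W : Type v} [AddCommGroup W] [Module K W]
  {S : Type w} [Fintype S] [DecidableEq S]

/-- The **tensor basis** of `T^{a,b}_K W = W^{⊗a} ⊗ (W^∨)^{⊗b}` induced by a basis `e` of `W`:
`(β, γ) ↦ (⊗ₖ e (β k)) ⊗ (⊗ₗ e^∨ (γ l))`, `e^∨ = e.dualBasis` (Deligne, LNM 900, I §3.1: the
spaces `T^{m₁,m₂}`; Mathlib's `Basis.piTensorProduct`, `Module.Basis.tensorProduct`,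
`Module.Basis.dualBasis`). [folklore] -/
def hodgeTensorBasis (e : Module.Basis S K W) (a b : ℕ) :
    Module.Basis ((Fin a → S) × (Fin b → S)) K (hodgeTensorSpaceOver K W a b) :=
  (Basis.piTensorProduct fun _ : Fin a => e).tensorProduct
    (Basis.piTensorProduct fun _ : Fin b => e.dualBasis)

/-- The tensor basis vectors are the pure tensors of basis and dual-basis vectors. [folklore] -/
theorem hodgeTensorBasis_apply (e : Module.Basis S K W) (a b : ℕ) (β : Fin a → S) (γ : Fin b → S) :
    hodgeTensorBasis e a b (β, γ) =
      (PiTensorProduct.tprod K fun k => e (β k)) ⊗ₜ[K]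
        PiTensorProduct.tprod K fun l => e.dualBasis (γ l) := by
  simp [hodgeTensorBasis, Basis.piTensorProduct_apply]

/-- A dual-basis vector precomposed with the inverse of an automorphism diagonal in the basis is
scaled by the inverse eigenvalue: `e^∨_τ ∘ g⁻¹ = (u τ)⁻¹ • e^∨_τ`. [folklore] -/
theorem dualBasis_comp_symm_of_diag (e : Module.Basis S K W) {g : W ≃ₗ[K] W} {u : S → K}
    (hg : ∀ σ, g (e σ) = u σ • e σ) (τ : S) :
    (e.dualBasis τ).comp (g.symm : W →ₗ[K] W) = (u τ)⁻¹ • e.dualBasis τ := by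
  have hu : ∀ σ, u σ ≠ 0 := by
    intro σ h0
    have := hg σ
    rw [h0, zero_smul] at this
    exact e.ne_zero σ (g.injective (this.trans (map_zero g).symm))
  have hsymm : ∀ σ, g.symm (e σ) = (u σ)⁻¹ • e σ := by
    intro σ
    apply g.injective
    rw [LinearEquiv.apply_symm_apply, map_smul, hg, smul_smul, inv_mul_cancel₀ (hu σ), one_smul]
  refine e.ext fun σ => ?_
  by_cases h : σ = τ
  · subst h
    simp [hsymm]
  · simp [hsymm, h]

/-- **Diagonal automorphisms act diagonally on the tensor basis.** If `g (e σ) = u σ • e σ` for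
all `σ`, then `g` acts on `(⊗ₖ e (β k)) ⊗ (⊗ₗ e^∨ (γ l))` by the scalar
`(∏ₖ u (β k)) (∏ₗ u (γ l))⁻¹` (Deligne, LNM 900, I, proof of 3.4: `μ(λ)` acts on tensors of
type `(P,Q)` through `λ^{-P}`). [cite: Deligne1982HodgeCycles, I proof of Prop. 3.4] -/
theorem tensorSpaceActOver_hodgeTensorBasis (e : Module.Basis S K W) {a b : ℕ} {g : W ≃ₗ[K] W}
    {u : S → K} (hg : ∀ σ, g (e σ) = u σ • e σ) (β : Fin a → S) (γ : Fin b → S) :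
    tensorSpaceActOver g (hodgeTensorBasis e a b (β, γ)) =
      ((∏ k, u (β k)) * (∏ l, u (γ l))⁻¹) • hodgeTensorBasis e a b (β, γ) := by
  rw [hodgeTensorBasis_apply, tensorSpaceActOver_tmul_tprod]
  have h₁ : (PiTensorProduct.tprod K fun k => g (e (β k))) =
      (∏ k, u (β k)) • PiTensorProduct.tprod K fun k => e (β k) := by
    have : (fun k => g (e (β k))) = fun k => u (β k) • e (β k) := funext fun k => hg (β k)
    rw [this, MultilinearMap.map_smul_univ]
  have h₂ : (PiTensorProduct.tprod K fun l => (e.dualBasis (γ l)).comp (g.symm : W →ₗ[K] W)) =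
      (∏ l, u (γ l))⁻¹ • PiTensorProduct.tprod K fun l => e.dualBasis (γ l) := by
    have : (fun l => (e.dualBasis (γ l)).comp (g.symm : W →ₗ[K] W)) =
        fun l => (u (γ l))⁻¹ • e.dualBasis (γ l) := funext fun l => dualBasis_comp_symm_of_diag e hg _
    rw [this, MultilinearMap.map_smul_univ, Finset.prod_inv_distrib]
  rw [h₁, h₂, TensorProduct.smul_tmul_smul]

/-- The group version of the diagonal action as a statement about the linear map underlying
`tensorSpaceActOver g`: it is diagonal in the tensor basis. [folklore] -/
theorem tensorSpaceActOver_hodgeTensorBasis' (e : Module.Basis S K W) {a b : ℕ} {g : W ≃ₗ[K] W}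
    {u : S → K} (hg : ∀ σ, g (e σ) = u σ • e σ) (x : (Fin a → S) × (Fin b → S)) :
    (tensorSpaceActOver (a := a) (b := b) g).toLinearMap (hodgeTensorBasis e a b x) =
      ((∏ k, u (x.1 k)) * (∏ l, u (x.2 l))⁻¹) • hodgeTensorBasis e a b x :=
  tensorSpaceActOver_hodgeTensorBasis e hg x.1 x.2

end TensorBasis

end Literature.AlgebraicGeometry.Motives

end
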